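import Summits.ResolutionOfSingularities.ResolutionOfSingularities.Theorems.PurelyInseparableDim4Target
import Literature.AlgebraicGeometry.Hironaka2017.Lib.SpecOrdersDiff
import Literature.AlgebraicGeometry.Resolution.OrdZeroBasics
import Literature.AlgebraicGeometry.Resolution.DerivativeIdealsOrder
import Literature.RingTheory.KrullDimension.FibreInequality
import Mathlib.FieldTheory.Perfect
import Mathlib.RingTheory.Nullstellensatz
import HarnessLib

/-!
# Purely inseparable four-folds `z^p + F(x₁, …, x₄)`: equimultiple points = order-`p` points (brick TY-3, S3 (b))

[OURS · counted 0] (cell `res-dim4-pi`, D-0157 DOOR 2 wave 2, desk table `boards/WAVE2.md` row TY-3; host item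
stmt-ResolutionOfSingularities-16155, helper). Nothing in this file proves resolution of singularities in dimension
≥ 4 / characteristic `p`; it is the elementary dictionary between the MODEL predicate `CentreBlowup.IsEquimultiplePoint`
of the tree's coordinate-centre walk (`PointBlowupShadeCentres.lean`: "all non-constant monomials of degree `< q` of the
translated chart transform vanish") and the SCHEME-LEVEL order `idealOrder` (`MarkedIdeals.lean`, BGMW §3.1) of the
hypersurface `z^p + G(x)` on `𝔸⁵_K` at a closed point — the language of the target frame `PIDim4.OrderReduction`
(marked ideal `(𝔸⁵, (z^p + F), ∅, p)`, `PurelyInseparableDim4Target.lean`).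

* §1 (model; any ring, `q`, index type): `isEquimultiplePoint_iff_le_ordZero_step` —
  `IsEquimultiplePoint q S j b s ↔ q ≤ ord₀ (step q S j b s).F` (exponents of degree `1, …, q − 1` are never `q`-th power
  exponents, so cleaning `Hauser2010.deletePthPowers` removes only the constant below degree `q`; the point-centre one-way
  forms `PointBlowup.le_ordZero_step_of_isEquimultiplePoint` / `…isEquimultiplePoint_of_le_ordZero_step` are in the tree).
* §2 (translations): `translate_mem_idealOfVars_pow_iff`, `natCast_le_ordZero_translate_iff_mem_vanishingIdeal_pow` —
  `n ≤ ord₀ G(x + v) ↔ G ∈ 𝔪_vⁿ` (tree: `idealOfVars_map_translate`, `vanishingIdeal_singleton_eq_span`,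
  `natCast_le_ordZero_iff_mem_idealOfVars_pow`).
* §3 (the hypersurface, char `p`): `translate_hyp` (`(z + a)^p + G(x + b) = z^p + a^p + G(x + b)`),
  `ordZero_translate_hyp_le` (`≤ p` everywhere), `natCast_le_ordZero_translate_hyp_iff`:
  **`p ≤ ord_{(a,b)}(z^p + G) ↔ a^p + G(b) = 0 ∧ ∀ d ≠ 0, |d| < p → coeff_d G(x + b) = 0`**.
* §4 (scheme level, `K`-rational closed points of `𝔸⁵_K = AffinePointBlowup.P 4 K`, via
  `Hironaka2017.Lib.SpecOrdersDiff`): `hypSheaf_eq_shf`, `natCast_le_idealOrder_hypSheaf_iff`, `idealOrder_hypSheaf_le`,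
  and the brick **`isEquimultiplePoint_iff_idealOrder_ge`**: for `G = CentreBlowup.chartTransform p S j s.F` (the
  `x_j`-chart of the blow-up of `V(z, x_S)` BEFORE translation and cleaning) and a point `(a, b)` of `V(z^p + G)`:
  `IsEquimultiplePoint p S j b s ↔ p ≤ ord_{(a,b)} (z^p + G)` (= membership in `supp((z^p + G), E, p)`,
  `mem_support_iff_isEquimultiplePoint`).
* §5 (which closed points): over a PERFECT field the point of `V(z^p + G)` over `b` is unique
  (`existsUnique_pow_add_eq_zero`); `X_succ_mem_asIdeal_iff` (on the exceptional hyperplane `x_j = 0` iff `b_j = 0`);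
  over an ALGEBRAICALLY CLOSED field every closed point is rational: `le_idealOrder_hypSheaf_iff_of_isClosed` — the closed
  points of order `p` of `V(z^p + G)` are exactly the `(a, b)` with `a^p + G(b) = 0` and `IsEquimultiplePoint p S j b s`.

The constant `G(b)` is not required to vanish in `IsEquimultiplePoint` (it is absorbed by `z ↦ z − G(b)^{1/p}` over a
perfect field); here it is the separate clause `a^p + G(b) = 0` choosing the point over `b`. NOT here: the chart dictionary
«transform of `V(z^p + F)` in the `x_j`-chart = `V(z^p + chartTransform)`» (brick TY-2), and anything global.
Sources: [Hauser2010] §C, §F; [HauserPerlega2019PRIMS] §2; [BierstoneGrigorievMilmanWlodarczyk2011] §3.1;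
[ZariskiSamuel1960] II Ch. VII §1, VIII §1. AI-produced formalisation, weaker than expert review.
bears_on: LADDER-RESOLUTION:D157-DOOR2 (res-dim4-pi · TY-3).
-/


set_option linter.dupNamespace false -- D-0017: single-problem summit path `Summit.<S>.<S>.…` by design

noncomputable section

open MvPolynomial Finset AlgebraicGeometry

namespace Summit.ResolutionOfSingularities.ResolutionOfSingularities.Theorems.PIDim4

open Literature.AlgebraicGeometry.Resolution
open Literature.AlgebraicGeometry.Resolution.Hauser2010
open Literature.AlgebraicGeometry.Hironaka2017.SpecOrders

namespace Equimultiple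

/-! ## §1 The model reading: equimultiple point ⟺ the cleaned transform has order `≥ q` -/

section Model

variable {σ : Type*} {R : Type*} [CommRing R] [DecidableEq σ] [DecidableEq R]

omit [DecidableEq σ] in
/-- A non-zero exponent of total degree `< q` is not a `q`-th power exponent (some `0 < dᵢ < q`). [folklore] -/
theorem not_isPthPowerExponent_of_degree_lt {q : ℕ} {d : σ →₀ ℕ} (hd0 : d ≠ 0) (hdq : d.degree < q) :
    ¬ IsPthPowerExponent q d := by
  intro hpow
  obtain ⟨i, hi⟩ : ∃ i, d i ≠ 0 := not_forall.mp fun hall => hd0 (Finsupp.ext hall)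
  exact hi (Nat.eq_zero_of_dvd_of_lt ((isPthPowerExponent_iff q d).mp hpow i)
    (lt_of_le_of_lt (Finsupp.le_degree i d) hdq))

/-- **Equimultiple point ⟺ the next state is again of order `≥ q`.** For the coordinate-centre walk
(`CentreBlowup.step` = chart transform, translation to `b`, cleaning): `b` is an equimultiple point above the
centre `C_S` in the chart `y_j` iff the cleaned residual polynomial of the new state has order `≥ q` at the origin.
Cleaning deletes the constant term (exponent `0` is a `q`-th power exponent) and no other monomial of degree `< q`.
Any commutative ring, any `q`, any index type. [cite: Hauser2010, §F (equiconstant points)] -/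
theorem isEquimultiplePoint_iff_le_ordZero_step (q : ℕ) (S : Finset σ) (j : σ) (b : σ → R)
    (s : CentreBlowup.CState σ R) :
    CentreBlowup.IsEquimultiplePoint q S j b s ↔ (q : ℕ∞) ≤ ordZero (CentreBlowup.step q S j b s).F := by
  rw [natCast_le_ordZero_iff_forall_coeff]
  change _ ↔ ∀ d : σ →₀ ℕ, d.degree < q → coeff d (deletePthPowers q (CentreBlowup.pointTransform q S j b s)) = 0
  simp only [coeff_deletePthPowers]
  constructor
  · intro h d hd
    split_ifs with hP
    · rfl
    · exact h d (by rintro rfl; exact hP fun i hi => by simp at hi) hd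
  · intro h d hd0 hdq
    have := h d hdq
    rwa [if_neg (not_isPthPowerExponent_of_degree_lt hd0 hdq)] at this

end Model

/-! ## §2 Translations: order at a rational point `v` = order of the translate at the origin -/

section Translate

variable {σ : Type*} {R : Type*} [CommRing R]

/-- The constant term of `G(x + v)` is `G(v)`. [folklore] -/
theorem coeff_zero_translate (v : σ → R) (G : MvPolynomial σ R) :
    coeff 0 (PointBlowup.translate v G) = eval v G := by
  have h : constantCoeff.comp (aeval fun i => (X i + C (v i) : MvPolynomial σ R)).toRingHom = eval v := by
    refine MvPolynomial.ringHom_ext (fun r => ?_) (fun i => ?_) <;> simp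
  exact DFunLike.congr_fun h G

/-- **Translating the point to the origin**: `G(x + v) ∈ 𝔪₀ⁿ ↔ G ∈ 𝔪_vⁿ`, where `𝔪₀ = (xᵢ : i)` and
`𝔪_v = (xᵢ − vᵢ : i)` (the translation `xᵢ ↦ xᵢ − vᵢ` is a ring automorphism carrying `𝔪₀` onto `𝔪_v`,
tree `Resolution.idealOfVars_map_translate`). [cite: AtiyahMacdonald1969, Ch. 1 Ex. 18] -/
theorem translate_mem_idealOfVars_pow_iff (v : σ → R) (G : MvPolynomial σ R) (n : ℕ) :
    PointBlowup.translate v G ∈ MvPolynomial.idealOfVars σ R ^ n ↔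
      G ∈ Ideal.span (Set.range fun i => (X i : MvPolynomial σ R) - C (v i)) ^ n := by
  obtain ⟨e, he⟩ := exists_algEquiv_translate v
  -- `e (G(x + v)) = G`, `e⁻¹ G = G(x + v)`
  have heT : e (PointBlowup.translate v G) = G := by
    have hcomp : (e : MvPolynomial σ R →ₐ[R] MvPolynomial σ R).comp
        (aeval fun i => (X i + C (v i) : MvPolynomial σ R)) = AlgHom.id R _ := by
      refine MvPolynomial.algHom_ext fun i => ?_
      have hC : e (C (v i)) = C (v i) := e.commutes (v i)
      simp [he i, hC]
    exact DFunLike.congr_fun hcomp G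
  have hsymm : e.symm G = PointBlowup.translate v G := by
    have h := e.symm_apply_apply (PointBlowup.translate v G)
    rwa [heT] at h
  have hmap : (MvPolynomial.idealOfVars σ R ^ n).map (e : MvPolynomial σ R →+* MvPolynomial σ R) =
      Ideal.span (Set.range fun i => (X i : MvPolynomial σ R) - C (v i)) ^ n := by
    rw [Ideal.map_pow, idealOfVars_map_translate he]
  rw [← hmap]
  constructor
  · intro h
    have h2 := Ideal.mem_map_of_mem (e : MvPolynomial σ R →+* MvPolynomial σ R) h
    rwa [show (e : MvPolynomial σ R →+* MvPolynomial σ R) (PointBlowup.translate v G) = G from heT] at h2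
  · intro h
    have h2 := Ideal.mem_map_of_mem (e.symm : MvPolynomial σ R →+* MvPolynomial σ R) h
    rw [Ideal.map_map, show (e.symm : MvPolynomial σ R →+* MvPolynomial σ R).comp
        (e : MvPolynomial σ R →+* MvPolynomial σ R) = RingHom.id _ from
      RingHom.ext fun x => e.symm_apply_apply x, Ideal.map_id] at h2
    rwa [show (e.symm : MvPolynomial σ R →+* MvPolynomial σ R) G = PointBlowup.translate v G from hsymm] at h2

variable {K : Type*} [Field K]

/-- At a rational point of affine space: `G ∈ 𝔪_vⁿ ↔ G(x + v) ∈ 𝔪₀ⁿ`. [cite: AtiyahMacdonald1969, Ch. 1 Ex. 18] -/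
theorem mem_vanishingIdeal_singleton_pow_iff (v : σ → K) (G : MvPolynomial σ K) (n : ℕ) :
    G ∈ MvPolynomial.vanishingIdeal K {v} ^ n ↔
      PointBlowup.translate v G ∈ MvPolynomial.idealOfVars σ K ^ n := by
  rw [Literature.RingTheory.KrullDimension.vanishingIdeal_singleton_eq_span, translate_mem_idealOfVars_pow_iff]

/-- **`n ≤ ord₀ G(x + v) ↔ G ∈ 𝔪_vⁿ`**: the order of `G` at the rational point `v` is the order of its translate
at the origin. [cite: ZariskiSamuel1960, Vol. II Ch. VII §1 p.130 (the ideal of series of order ≥ n is 𝔪ⁿ)] -/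
theorem natCast_le_ordZero_translate_iff_mem_vanishingIdeal_pow (v : σ → K) (G : MvPolynomial σ K) (n : ℕ) :
    (n : ℕ∞) ≤ ordZero (PointBlowup.translate v G) ↔ G ∈ MvPolynomial.vanishingIdeal K {v} ^ n := by
  rw [natCast_le_ordZero_iff_mem_idealOfVars_pow, mem_vanishingIdeal_singleton_pow_iff]

end Translate

/-! ## §3 The hypersurface `z^p + G(x₁, …, x₄)` at the point `(a, b)` -/

section Hyp

variable {K : Type} [Field K] {p : ℕ} [hp : Fact p.Prime] [CharP K p]

/-- **Translating `z^p + G` to the point `(a, b)`** (characteristic `p`):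
`(z + a)^p + G(x + b) = z^p + a^p + G(x + b)`. [folklore] -/
theorem translate_hyp (G : MvPolynomial (Fin 4) K) (a : K) (b : Fin 4 → K) :
    PointBlowup.translate (Fin.cons a b : Fin (4 + 1) → K) (hyp p G) =
      X 0 ^ p + C (a ^ p) + rename Fin.succ (PointBlowup.translate b G) := by
  have hcomp : (aeval fun i : Fin (4 + 1) => (X i + C ((Fin.cons a b : Fin (4 + 1) → K) i) :
        MvPolynomial (Fin (4 + 1)) K)).comp (rename Fin.succ) =
      (rename Fin.succ).comp (aeval fun i : Fin 4 => (X i + C (b i) : MvPolynomial (Fin 4) K)) := by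
    refine MvPolynomial.algHom_ext fun i => ?_
    simp [Fin.cons_succ]
  have hG := DFunLike.congr_fun hcomp G
  simp only [AlgHom.comp_apply] at hG
  unfold PointBlowup.translate hyp
  rw [map_add, map_pow, aeval_X, hG, Fin.cons_zero, add_pow_char, ← map_pow]

omit hp [CharP K p] in
/-- The coefficient of `z^p` in `z^p + c + H(x)` (`H` in the `x`-variables only) is `1`. [folklore] -/
theorem coeff_single_zero_hypForm (hp0 : p ≠ 0) (c : K) (H : MvPolynomial (Fin 4) K) :
    coeff (Finsupp.single 0 p) (X 0 ^ p + C c + rename Fin.succ H : MvPolynomial (Fin (4 + 1)) K) = 1 := by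
  have h1 : coeff (Finsupp.single 0 p) (X 0 ^ p : MvPolynomial (Fin (4 + 1)) K) = 1 := by
    rw [X_pow_eq_monomial, coeff_monomial, if_pos rfl]
  have h2 : coeff (Finsupp.single 0 p) (C c : MvPolynomial (Fin (4 + 1)) K) = 0 := by
    rw [coeff_C, if_neg (Finsupp.single_ne_zero.mpr hp0).symm]
  have h3 : coeff (Finsupp.single 0 p) (rename Fin.succ H : MvPolynomial (Fin (4 + 1)) K) = 0 := by
    refine coeff_rename_eq_zero _ _ _ fun u hu => absurd (congrArg (fun d : Fin (4 + 1) →₀ ℕ => d 0) hu) ?_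
    rw [Finsupp.mapDomain_notin_range _ _ fun ⟨i, hi⟩ => Fin.succ_ne_zero i hi, Finsupp.single_eq_same]
    exact fun h => hp0 h.symm
  rw [coeff_add, coeff_add, h1, h2, h3, add_zero, add_zero]

/-- **The order of `z^p + G` at any rational point is `≤ p`** (the monomial `z^p` survives translation).
[cite: Hauser2010, §C (order of X at a point)] -/
theorem ordZero_translate_hyp_le (G : MvPolynomial (Fin 4) K) (a : K) (b : Fin 4 → K) :
    ordZero (PointBlowup.translate (Fin.cons a b : Fin (4 + 1) → K) (hyp p G)) ≤ p := by
  rw [translate_hyp]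
  have h := coeff_single_zero_hypForm (K := K) hp.out.ne_zero (a ^ p) (PointBlowup.translate b G)
  have hne : MvPowerSeries.coeff (Finsupp.single (0 : Fin (4 + 1)) p)
      ((X 0 ^ p + C (a ^ p) + rename Fin.succ (PointBlowup.translate b G) : MvPolynomial (Fin (4 + 1)) K) :
        MvPowerSeries (Fin (4 + 1)) K) ≠ 0 := by
    rw [MvPolynomial.coeff_coe, h]
    exact one_ne_zero
  have := MvPowerSeries.order_le hne
  rwa [Finsupp.degree_single] at this

omit hp [CharP K p] in
/-- The low-degree coefficients of `z^p + c + H(x)`: for `|e| < p`, `coeff_e = [e = 0]·c + coeff_e H(x)`. [folklore] -/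
theorem coeff_hypForm_of_degree_lt (c : K) (H : MvPolynomial (Fin 4) K) {e : Fin (4 + 1) →₀ ℕ}
    (he : e.degree < p) :
    coeff e (X 0 ^ p + C c + rename Fin.succ H : MvPolynomial (Fin (4 + 1)) K) =
      (if e = 0 then c else 0) + coeff e (rename Fin.succ H : MvPolynomial (Fin (4 + 1)) K) := by
  have h1 : coeff e (X 0 ^ p : MvPolynomial (Fin (4 + 1)) K) = 0 := by
    rw [X_pow_eq_monomial, coeff_monomial, if_neg]
    rintro rfl
    rw [Finsupp.degree_single] at he
    exact lt_irrefl p he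
  have h2 : coeff e (C c : MvPolynomial (Fin (4 + 1)) K) = if e = 0 then c else 0 := by
    rw [coeff_C]
    by_cases he0 : e = 0
    · rw [if_pos he0.symm, if_pos he0]
    · rw [if_neg (Ne.symm he0), if_neg he0]
  rw [coeff_add, coeff_add, h1, h2, zero_add]

/-- **The order-`p` criterion at a rational point.** For `G ∈ K[x₁..x₄]`, `char K = p`, and a point `(a, b)`:
`p ≤ ord_{(a,b)} (z^p + G)` iff `(a, b)` lies on the hypersurface (`a^p + G(b) = 0`) AND every non-constant monomial of
degree `< p` of `G(x + b)` vanishes — the latter is the tree's `IsEquimultiplePoint` clause; the constant `G(b)` is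
free because over a perfect field it is a `p`-th power, absorbed by `z ↦ z − G(b)^{1/p}`.
[cite: Hauser2010, §F (equiconstant points)] -/
theorem natCast_le_ordZero_translate_hyp_iff (G : MvPolynomial (Fin 4) K) (a : K) (b : Fin 4 → K) :
    (p : ℕ∞) ≤ ordZero (PointBlowup.translate (Fin.cons a b : Fin (4 + 1) → K) (hyp p G)) ↔
      a ^ p + eval b G = 0 ∧
        ∀ d : Fin 4 →₀ ℕ, d ≠ 0 → d.degree < p → coeff d (PointBlowup.translate b G) = 0 := by
  rw [translate_hyp, natCast_le_ordZero_iff_forall_coeff]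
  set T := PointBlowup.translate b G with hT
  have hc : coeff (0 : Fin (4 + 1) →₀ ℕ) (rename Fin.succ T : MvPolynomial (Fin (4 + 1)) K) = eval b G := by
    rw [← coeff_zero_translate b G, hT]
    exact constantCoeff_rename _ _
  constructor
  · intro H
    refine ⟨?_, fun d hd0 hdp => ?_⟩
    · -- the constant term
      have hdeg0 : (0 : Fin (4 + 1) →₀ ℕ).degree < p := by rw [map_zero]; exact hp.out.pos
      have h0 := H 0 hdeg0
      rwa [coeff_hypForm_of_degree_lt (K := K) _ _ hdeg0, if_pos rfl, hc] at h0
    · -- a non-constant exponent `d` of the `x`-variables, moved to `𝔸⁵`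
      have he : (d.mapDomain Fin.succ).degree < p := by rwa [Finsupp.degree_mapDomain]
      have h1 := H _ he
      rwa [coeff_hypForm_of_degree_lt (K := K) _ _ he, if_neg fun h0 => hd0 (Finsupp.mapDomain_injective
        (Fin.succ_injective 4) (by rwa [Finsupp.mapDomain_zero])), zero_add,
        coeff_rename_mapDomain _ (Fin.succ_injective 4)] at h1
  · rintro ⟨hab, H⟩ e he
    rw [coeff_hypForm_of_degree_lt (K := K) _ _ he]
    by_cases he0 : e = 0
    · subst he0
      rw [if_pos rfl, hc, hab]
    · rw [if_neg he0, zero_add]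
      refine coeff_rename_eq_zero _ _ _ fun u hu => H u ?_ ?_
      · rintro rfl
        exact he0 (by rw [← hu, Finsupp.mapDomain_zero])
      · rwa [← hu, Finsupp.degree_mapDomain] at he

end Hyp

/-! ## §4 Scheme level: the order of the ideal sheaf `(z^p + G)` on `𝔸⁵_K` at a rational closed point -/

section SchemeLevel

variable {K : Type} [Field K] {p : ℕ}

/-- The ideal sheaf `hypSheaf p G` of the target frame is the ideal sheaf `shf (z^p + G)` of the principal ideal
`(z^p + G) ≤ K[z, x₁, …, x₄]` in the sense of `Hironaka2017.Lib.SpecOrders`. [folklore] -/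
theorem hypSheaf_eq_shf (G : MvPolynomial (Fin 4) K) :
    hypSheaf p G = shf (AffinePointBlowup.A 4 K) (Ideal.span {hyp p G}) := by
  rw [hypSheaf, shf, Ideal.map_span, Set.image_singleton]
  rfl

/-- **`n ≤ ord_x (z^p + G) ↔ n ≤ ord₀ ((z^p + G)(· + v))`** at the `K`-rational closed point `x` of `𝔸⁵_K` with
`𝔪_x = 𝔪_v` (`𝔪_vⁿ` is `𝔪_v`-primary, tree `SpecOrdersDiff.le_idealOrder_shf_span_singleton_iff_mem_vanishingIdeal_pow`).
[cite: ZariskiSamuel1960, Vol. I Ch. IV §12 (powers of maximal ideals are primary) and Vol. II Ch. VIII §1] -/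
theorem natCast_le_idealOrder_hypSheaf_iff (G : MvPolynomial (Fin 4) K) {x : AffinePointBlowup.P 4 K}
    {v : Fin (4 + 1) → K} (hx : x.asIdeal = MvPolynomial.vanishingIdeal K {v}) (n : ℕ) :
    (n : ℕ∞) ≤ idealOrder (hypSheaf p G) x ↔ (n : ℕ∞) ≤ ordZero (PointBlowup.translate v (hyp p G)) := by
  rw [hypSheaf_eq_shf, le_idealOrder_shf_span_singleton_iff_mem_vanishingIdeal_pow (hyp p G) hx n,
    natCast_le_ordZero_translate_iff_mem_vanishingIdeal_pow]

variable [hp : Fact p.Prime] [CharP K p]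

/-- **`ord_x (z^p + G) ≤ p` at every rational closed point `x` of `𝔸⁵_K`.** [cite: Hauser2010, §C (order of X at a point)] -/
theorem idealOrder_hypSheaf_le (G : MvPolynomial (Fin 4) K) {x : AffinePointBlowup.P 4 K} (a : K)
    (b : Fin 4 → K) (hx : x.asIdeal = MvPolynomial.vanishingIdeal K {(Fin.cons a b : Fin (4 + 1) → K)}) :
    idealOrder (hypSheaf p G) x ≤ p := by
  by_contra h
  rw [not_le] at h
  have h1 : ((p + 1 : ℕ) : ℕ∞) ≤ idealOrder (hypSheaf p G) x := by
    rw [Nat.cast_succ]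
    exact Order.add_one_le_of_lt h
  rw [natCast_le_idealOrder_hypSheaf_iff G hx] at h1
  have h2 := h1.trans (ordZero_translate_hyp_le G a b)
  have : p + 1 ≤ p := by exact_mod_cast h2
  omega

/-- **Brick TY-3 / S3 (b): equimultiple points = order-`p` points.** Let `G = chartTransform p S j s.F` be the
`x_j`-chart transform of the residual polynomial under the blow-up of the coordinate centre `V(z, x_S)` (so that
`V(z^p + G)` is the chart's transform of `V(z^p + F)` BEFORE translation and cleaning — the TY-2 dictionary), and let
`x` be the `K`-rational closed point `(a, b)` of `𝔸⁵_K` lying on `V(z^p + G)` (`a^p + G(b) = 0`). Then `b` is an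
equimultiple point of the model (`CentreBlowup.IsEquimultiplePoint p S j b s`) iff the hypersurface `z^p + G` has
order (multiplicity) `≥ p` — hence exactly `p`, `idealOrder_hypSheaf_le` — at `x`.
[cite: Hauser2010, §F (equiconstant points: "a point above a where the order of X' has remained constant")] -/
theorem isEquimultiplePoint_iff_idealOrder_ge (S : Finset (Fin 4)) (j : Fin 4) (b : Fin 4 → K) (s : State K)
    (a : K) (hab : a ^ p + eval b (CentreBlowup.chartTransform p S j s.F) = 0) {x : AffinePointBlowup.P 4 K}
    (hx : x.asIdeal = MvPolynomial.vanishingIdeal K {(Fin.cons a b : Fin (4 + 1) → K)}) :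
    CentreBlowup.IsEquimultiplePoint p S j b s ↔
      (p : ℕ∞) ≤ idealOrder (hypSheaf p (CentreBlowup.chartTransform p S j s.F)) x := by
  rw [natCast_le_idealOrder_hypSheaf_iff _ hx, natCast_le_ordZero_translate_hyp_iff]
  simp only [hab, true_and]
  rfl

/-- The same, read as membership in the support `{ord ≥ p}` of the marked ideal `((z^p + G), E, p)` on `𝔸⁵_K`
(BGMW Def. 3.1.2; `E` arbitrary). [cite: BierstoneGrigorievMilmanWlodarczyk2011, Def. 3.1.2] -/
theorem mem_support_iff_isEquimultiplePoint (S : Finset (Fin 4)) (j : Fin 4) (b : Fin 4 → K) (s : State K)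
    (a : K) (hab : a ^ p + eval b (CentreBlowup.chartTransform p S j s.F) = 0) {x : AffinePointBlowup.P 4 K}
    (hx : x.asIdeal = MvPolynomial.vanishingIdeal K {(Fin.cons a b : Fin (4 + 1) → K)})
    (E : List (AffinePointBlowup.P 4 K).IdealSheafData) :
    x ∈ (⟨hypSheaf p (CentreBlowup.chartTransform p S j s.F), E, p⟩ :
        MarkedIdeal (AffinePointBlowup.P 4 K)).support ↔
      CentreBlowup.IsEquimultiplePoint p S j b s := by
  rw [isEquimultiplePoint_iff_idealOrder_ge S j b s a hab hx]
  rfl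

end SchemeLevel

/-! ## §5 Which closed points: perfect fields (unique point over `b`), the exceptional hyperplane, algebraically
closed fields (every closed point is rational) -/

section Points

variable {K : Type} [Field K] {p : ℕ} [hp : Fact p.Prime] [CharP K p]

/-- Over a PERFECT field of characteristic `p`, above every `b` there is exactly one point of `V(z^p + G)`:
the unique `a` with `a^p + c = 0` (`c = G(b)`), Frobenius being bijective. [folklore] -/
theorem existsUnique_pow_add_eq_zero [PerfectRing K p] (c : K) : ∃! a : K, a ^ p + c = 0 := by
  refine ⟨(frobeniusEquiv K p).symm (-c), ?_, fun a ha => ?_⟩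
  · change frobenius K p ((frobeniusEquiv K p).symm (-c)) + c = 0
    rw [frobenius_apply_frobeniusEquiv_symm, neg_add_cancel]
  · apply (frobeniusEquiv K p).injective
    rw [RingEquiv.apply_symm_apply, frobeniusEquiv_def]
    exact eq_neg_of_add_eq_zero_left ha

omit hp [CharP K p] in
/-- The rational point `(a, b)` lies on the exceptional hyperplane `x_j = 0` of the `x_j`-chart iff `b_j = 0`.
[cite: HauserPerlega2019PRIMS, §2 (the blowup in the x₁-chart)] -/
theorem X_succ_mem_asIdeal_iff (j : Fin 4) (a : K) (b : Fin 4 → K) {x : AffinePointBlowup.P 4 K}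
    (hx : x.asIdeal = MvPolynomial.vanishingIdeal K {(Fin.cons a b : Fin (4 + 1) → K)}) :
    (X j.succ : AffinePointBlowup.A 4 K) ∈ x.asIdeal ↔ b j = 0 := by
  rw [hx, MvPolynomial.mem_vanishingIdeal_singleton_iff, aeval_X, Fin.cons_succ]

omit hp [CharP K p] in
/-- Over an algebraically closed field every closed point of `𝔸⁵_K` is rational: `𝔪_x = 𝔪_{(a,b)}` for a unique
pair `(a, b)`. [cite: AtiyahMacdonald1969, Ch. 7 Ex. 14 / Cor. 7.10 (weak Nullstellensatz)] -/
theorem exists_eq_vanishingIdeal_cons_of_isClosed [IsAlgClosed K] {x : AffinePointBlowup.P 4 K}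
    (hx : IsClosed ({x} : Set (AffinePointBlowup.P 4 K))) :
    ∃ (a : K) (b : Fin 4 → K), x.asIdeal = MvPolynomial.vanishingIdeal K {(Fin.cons a b : Fin (4 + 1) → K)} := by
  have hmax : x.asIdeal.IsMaximal := (PrimeSpectrum.isClosed_singleton_iff_isMaximal x).mp hx
  obtain ⟨v, hv⟩ := (MvPolynomial.isMaximal_iff_eq_vanishingIdeal_singleton (σ := Fin (4 + 1)) (K := K)).mp hmax
  exact ⟨v 0, Fin.tail v, by rw [hv, Fin.cons_self_tail]⟩

/-- **S3 (b) for the class of record (`K` algebraically closed): the closed points of order `p` of the chart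
hypersurface `V(z^p + G)`, `G = chartTransform p S j s.F`, are exactly the points `(a, b)` with `a^p + G(b) = 0` and
`IsEquimultiplePoint p S j b s`** (those on the exceptional hyperplane being the ones with `b_j = 0`,
`X_succ_mem_asIdeal_iff`). [cite: Hauser2010, §F (equiconstant points)] -/
theorem le_idealOrder_hypSheaf_iff_of_isClosed [IsAlgClosed K] (S : Finset (Fin 4)) (j : Fin 4) (s : State K)
    {x : AffinePointBlowup.P 4 K} (hx : IsClosed ({x} : Set (AffinePointBlowup.P 4 K))) :
    (p : ℕ∞) ≤ idealOrder (hypSheaf p (CentreBlowup.chartTransform p S j s.F)) x ↔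
      ∃ (a : K) (b : Fin 4 → K),
        x.asIdeal = MvPolynomial.vanishingIdeal K {(Fin.cons a b : Fin (4 + 1) → K)} ∧
          a ^ p + eval b (CentreBlowup.chartTransform p S j s.F) = 0 ∧ CentreBlowup.IsEquimultiplePoint p S j b s := by
  obtain ⟨a, b, hab⟩ := exists_eq_vanishingIdeal_cons_of_isClosed hx
  constructor
  · intro h
    rw [natCast_le_idealOrder_hypSheaf_iff _ hab, natCast_le_ordZero_translate_hyp_iff] at h
    exact ⟨a, b, hab, h.1, h.2⟩
  · rintro ⟨a', b', hab', hroot, heq⟩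
    rw [natCast_le_idealOrder_hypSheaf_iff _ hab', natCast_le_ordZero_translate_hyp_iff]
    exact ⟨hroot, heq⟩

end Points

end Equimultiple

end Summit.ResolutionOfSingularities.ResolutionOfSingularities.Theorems.PIDim4

end
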